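/-
Origin: expansion seat `planner-pub-hodgecm-pv11-g4-0`, handover #3 2026-08-18T06:59:42Z (`HOME/pub-hodgecm-pv11-g4/lean/Pv11g4/NormOneRelTorusArch.lean`, md5 01877d6b, 279 lines);
landed by the gen-7 packager in gate run 25 as `HodgeCM/PerL34/NormOneRelTorusArch.lean` (import ^import Pv[0-9]+g[0-9]+\.→import HodgeCM.PerL34. ×1).
-/
/-
Origin: expansion seat `planner-pub-hodgecm-pv11-g4-0` (unit `pub-hodgecm-pv11-g4`, DAG-NODE PROVER #11 gen 4), HodgeCM publication
cell, 2026-08-18.  WIP module `Pv11g4.NormOneRelTorusArch`; intended landing `HodgeCM/PerL34/NormOneRelTorusArch.lean`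
(one import rewrite: `Pv11g4.NormOneRelTorus` ↦ `HodgeCM.PerL34.NormOneRelTorus`).
-/
import Summits.HodgeConjecture.HodgeCM.PerL34.NormOneRelTorus_2

/-!
# The archimedean torus `U(W_j)(L₀ ⊗ ℝ)` and its embedding into `U(W_j)(𝔸)` (fields `B`, `i` of `SupplyBridgeA`)

`SupplyAdelic.SupplyBridgeA` carries, besides the automorphic-quotient block constructed in `NormOneRelTorus`, the
SETUP fields `B : Type`, `[Monoid B]`, `i : B →* DS.A₁` — "the archimedean torus `U(W_j)(L₀ ⊗ ℝ)` and its embedding as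
the archimedean component" (PerL §4.1; the weight character `w : B → ℂ` of `φ_∞` stays SETUP data).  This file
CONSTRUCTS them for the genuine torus of `NormOneRelTorus`:

* the `Aut(L/K)`-action on `L_∞^× = (InfiniteAdeleRing L)ˣ` and the Galois norm `NumberField.infGalNorm K L` on it;
* `NumberField.relNormOneInfUnits K L : Subgroup (InfiniteAdeleRing L)ˣ` — `U(1)_{L/K}(K ⊗_ℚ ℝ) := ker N_∞`
  (for a CM field: `{y ∈ L_∞^× : y ȳ = 1} = ∏_{w complex} U(1)`, membership lemma `mem_relNormOneInfUnits_iff_mul_conj`);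
* `NumberField.relNormOneInfToIdeles K L : relNormOneInfUnits K L →* relNormOneIdeles K L` — the archimedean component
  map `y ↦ (y, 1)` (pv10 `infUnitsToIdele`) lands in the torus (`N (y,1) = (N_∞ y, 1)`), and is injective;
* CM names `unitaryLineArchTorus L`, `unitaryLineArchEmbedding L : unitaryLineArchTorus L →* relNormOneIdeles L⁺ L`
  (`= (unitaryLineTorusDatum L).A` by `rfl`: `unitaryLineTorusDatum_A`);
* **compactness** (CM): `isCompact_unitaryLineArchTorus`, `instance compactSpace_unitaryLineArchTorus :
  CompactSpace (unitaryLineArchTorus L)` — complex conjugation fixes every infinite place of a CM field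
  (`complexConj_smul_infinitePlace`), so `y ȳ = 1` forces `‖y_w‖ = 1` at each place
  (`norm_apply_eq_one_of_mem_unitaryLineArchTorus`); the torus is closed (`isClosed_relNormOneInfUnits`, the Galois norm
  is continuous) and sits inside the compact polydisc `{‖x_w‖ ≤ 1 ∀ w}` (`InfiniteAdeleRing.isCompact_normLeOne`, each `L_w`
  embeds isometrically into `ℂ`) through the closed embedding `Units.embedProduct`.  (For a general `L/K` the archimedean
  torus need not be compact — e.g. a real quadratic `L/ℚ` — so this is stated for CM fields only.)

Everything is proved from `NormOneRelTorus` + the vendored Galois action (`instMulSemiringActionInfiniteAdeleRing`,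
`AdeleRing.smul_fst/snd`) + Mathlib; nothing is cited or posited.
-/

set_option autoImplicit false

noncomputable section

open Topology Set Function

namespace NumberField

open IsDedekindDomain
open Literature.NumberTheory Literature.NumberTheory.Automorphic

section Action

variable {K L : Type} [Field K] [Field L] [Algebra K L]

/-- `Aut(L/K)` acts on `L_∞^×` (units of the vendored action on `L_∞`). -/
instance instMulDistribMulActionInfiniteAdeleRingUnits :
    MulDistribMulAction (L ≃ₐ[K] L) (InfiniteAdeleRing L)ˣ :=
  Units.mulDistribMulActionRight

/-- (Ported verbatim from the HodgeCMPerL package; no docstring in the source.) -/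
@[simp] theorem InfiniteAdeleRing.coe_smul_units (σ : L ≃ₐ[K] L) (u : (InfiniteAdeleRing L)ˣ) :
    ((σ • u : (InfiniteAdeleRing L)ˣ) : InfiniteAdeleRing L) = σ • (u : InfiniteAdeleRing L) := rfl

variable [NumberField L]

/-- The archimedean-component idele `(y, 1)` of `y ∈ L_∞^×`. -/
theorem coe_infUnitsToIdele (y : (InfiniteAdeleRing L)ˣ) :
    ((infUnitsToIdele L y : ideleGroup L) : AdeleRing (𝓞 L) L) =
      ((y : InfiniteAdeleRing L), (1 : FiniteAdeleRing (𝓞 L) L)) := rfl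

/-- (Ported verbatim from the HodgeCMPerL package; no docstring in the source.) -/
theorem infUnitsToIdele_injective : Function.Injective (infUnitsToIdele L) := by
  intro a b h
  have h' := congrArg (fun u : ideleGroup L => ((u : AdeleRing (𝓞 L) L)).1) h
  simp only [coe_infUnitsToIdele] at h'
  exact Units.ext h'

/-- `σ • (y, 1) = (σ • y, 1)`. -/
theorem galSmul_infUnitsToIdele (σ : L ≃ₐ[K] L) (y : (InfiniteAdeleRing L)ˣ) :
    σ • infUnitsToIdele L y = infUnitsToIdele L (σ • y) := by
  apply Units.ext
  rw [AdeleRing.coe_smul_units, coe_infUnitsToIdele, coe_infUnitsToIdele]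
  refine Prod.ext ?_ ?_
  · rw [AdeleRing.smul_fst]; rfl
  · rw [AdeleRing.smul_snd]; exact smul_one σ

end Action

section ArchTorus

variable (K L : Type) [Field K] [Field L] [Algebra K L] [FiniteDimensional K L]

/-- The Galois norm on `L_∞^×`: `N_∞ y = ∏_{σ ∈ Aut(L/K)} σ • y`. -/
def infGalNorm : (InfiniteAdeleRing L)ˣ →* (InfiniteAdeleRing L)ˣ where
  toFun y := ∏ σ : L ≃ₐ[K] L, σ • y
  map_one' := by simp
  map_mul' y z := by
    rw [← Finset.prod_mul_distrib]
    exact Finset.prod_congr rfl fun σ _ => smul_mul' σ y z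

/-- (Ported verbatim from the HodgeCMPerL package; no docstring in the source.) -/
theorem infGalNorm_apply (y : (InfiniteAdeleRing L)ˣ) : infGalNorm K L y = ∏ σ : L ≃ₐ[K] L, σ • y := rfl

/-- **`U(1)_{L/K}(K ⊗ ℝ)`**, the archimedean torus: units of `L_∞` of relative norm one (field `B` of `SupplyBridgeA`
for the genuine `U(W_j)`). -/
def relNormOneInfUnits : Subgroup (InfiniteAdeleRing L)ˣ := (infGalNorm K L).ker

/-- (Ported verbatim from the HodgeCMPerL package; no docstring in the source.) -/
theorem mem_relNormOneInfUnits_iff (y : (InfiniteAdeleRing L)ˣ) :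
    y ∈ relNormOneInfUnits K L ↔ infGalNorm K L y = 1 := Iff.rfl

example : CommGroup (relNormOneInfUnits K L) := inferInstance

variable [NumberField L]

/-- `(N_∞ y, 1) = N (y, 1)`: the archimedean component map intertwines the two Galois norms. -/
theorem infUnitsToIdele_infGalNorm (y : (InfiniteAdeleRing L)ˣ) :
    infUnitsToIdele L (infGalNorm K L y) = AdeleRing.ideleGalNorm K L (infUnitsToIdele L y) := by
  rw [AdeleRing.ideleGalNorm_apply, infGalNorm_apply, map_prod]
  exact Finset.prod_congr rfl fun σ _ => (galSmul_infUnitsToIdele σ y).symm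

/-- (Ported verbatim from the HodgeCMPerL package; no docstring in the source.) -/
theorem infUnitsToIdele_mem_relNormOneIdeles {y : (InfiniteAdeleRing L)ˣ} (hy : y ∈ relNormOneInfUnits K L) :
    infUnitsToIdele L y ∈ relNormOneIdeles K L := by
  rw [mem_relNormOneIdeles_iff, ← infUnitsToIdele_infGalNorm, (mem_relNormOneInfUnits_iff K L y).mp hy, map_one]

/-- **The archimedean component embedding `U(1)(K ⊗ ℝ) → U(1)(𝔸_K)`**, `y ↦ (y, 1)` (field `i` of `SupplyBridgeA` for
the genuine `U(W_j)`). -/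
def relNormOneInfToIdeles : relNormOneInfUnits K L →* relNormOneIdeles K L :=
  ((infUnitsToIdele L).comp (relNormOneInfUnits K L).subtype).codRestrict (relNormOneIdeles K L)
    fun y => infUnitsToIdele_mem_relNormOneIdeles K L y.2

/-- (Ported verbatim from the HodgeCMPerL package; no docstring in the source.) -/
@[simp] theorem coe_relNormOneInfToIdeles (y : relNormOneInfUnits K L) :
    ((relNormOneInfToIdeles K L y : relNormOneIdeles K L) : ideleGroup L) = infUnitsToIdele L y := rfl

/-- (Ported verbatim from the HodgeCMPerL package; no docstring in the source.) -/
theorem relNormOneInfToIdeles_injective : Function.Injective (relNormOneInfToIdeles K L) := by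
  intro a b h
  have h' := congrArg (fun u : relNormOneIdeles K L => (u : ideleGroup L)) h
  simp only [coe_relNormOneInfToIdeles] at h'
  exact Subtype.ext (infUnitsToIdele_injective h')

/-- The idele norm of an archimedean torus element is one (as for every element of `U(1)(𝔸_K)`). -/
theorem ideleNorm_relNormOneInfToIdeles (y : relNormOneInfUnits K L) :
    ideleNorm L (infUnitsToIdele L (y : (InfiniteAdeleRing L)ˣ)) = 1 :=
  (mem_normOneIdeles_iff L _).mp
    (relNormOneIdeles_le_normOneIdeles K L (infUnitsToIdele_mem_relNormOneIdeles K L y.2))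

end ArchTorus

/-! ## The CM case: `U(W_j)(L₀ ⊗ ℝ) = {y ∈ L_∞^× : y ȳ = 1}` -/

section CM

variable (L : Type) [Field L] [NumberField L] [IsCMField L]

/-- (Ported verbatim from the HodgeCMPerL package; no docstring in the source.) -/
theorem infGalNorm_eq_mul_conj (y : (InfiniteAdeleRing L)ˣ) :
    infGalNorm (maximalRealSubfield L) L y = y * IsCMField.complexConj L • y := by
  classical
  rw [infGalNorm_apply, univ_eq_pair_complexConj, Finset.prod_pair (IsCMField.complexConj_ne_one L).symm, one_smul]

/-- For a CM field: `y ∈ U(1)(L⁺ ⊗ ℝ) ↔ y · ȳ = 1` in `L_∞^×` (so `U(W_j)(L₀ ⊗ ℝ) = ∏_{w} U(1)`, one circle per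
complex place). -/
theorem mem_relNormOneInfUnits_iff_mul_conj (y : (InfiniteAdeleRing L)ˣ) :
    y ∈ relNormOneInfUnits (maximalRealSubfield L) L ↔ y * IsCMField.complexConj L • y = 1 := by
  rw [mem_relNormOneInfUnits_iff, infGalNorm_eq_mul_conj]

/-- `U(W_j)(L₀ ⊗ ℝ)` for a hermitian line over the CM extension `L/L⁺`. -/
def unitaryLineArchTorus : Subgroup (InfiniteAdeleRing L)ˣ := relNormOneInfUnits (maximalRealSubfield L) L

/-- Its embedding as the archimedean component of the genuine torus `relNormOneIdeles L⁺ L = (unitaryLineTorusDatum L).A`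
(the pair `(B, i)` of `SupplyBridgeA`, constructed). -/
def unitaryLineArchEmbedding :
    unitaryLineArchTorus L →* relNormOneIdeles (maximalRealSubfield L) L :=
  relNormOneInfToIdeles (maximalRealSubfield L) L

omit [IsCMField L] in
/-- (Ported verbatim from the HodgeCMPerL package; no docstring in the source.) -/
theorem unitaryLineArchEmbedding_injective : Function.Injective (unitaryLineArchEmbedding L) :=
  relNormOneInfToIdeles_injective (maximalRealSubfield L) L

omit [IsCMField L] in
/-- The target of `unitaryLineArchEmbedding` is literally the carrier `A` of `unitaryLineTorusDatum L`. -/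
theorem unitaryLineTorusDatum_A : (unitaryLineTorusDatum L).A = ↥(relNormOneIdeles (maximalRealSubfield L) L) := rfl

end CM

/-! ## Compactness of the archimedean torus of a CM field: `U(W_j)(L₀ ⊗ ℝ) = ∏_w U(1)` is compact -/

section Continuity

variable (K L : Type) [Field K] [Field L] [Algebra K L]

/-- `y ↦ σ • y` is continuous on `L_∞^×` (units topology). -/
theorem continuous_galSmul_infUnits (σ : L ≃ₐ[K] L) : Continuous fun y : (InfiniteAdeleRing L)ˣ => σ • y := by
  refine Units.continuous_iff.mpr ⟨?_, ?_⟩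
  · exact (continuous_const_smul σ).comp Units.continuous_val
  · exact (continuous_const_smul σ).comp Units.continuous_coe_inv

variable [FiniteDimensional K L]

/-- The archimedean Galois norm is continuous. -/
theorem continuous_infGalNorm : Continuous (infGalNorm K L) := by
  change Continuous fun y : (InfiniteAdeleRing L)ˣ => ∏ σ : L ≃ₐ[K] L, σ • y
  exact continuous_finsetProd _ fun σ _ => continuous_galSmul_infUnits K L σ

/-- The archimedean torus is closed in `L_∞^×`. -/
theorem isClosed_relNormOneInfUnits : IsClosed (relNormOneInfUnits K L : Set (InfiniteAdeleRing L)ˣ) := by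
  rw [relNormOneInfUnits, MonoidHom.coe_ker]
  exact isClosed_singleton.preimage (continuous_infGalNorm K L)

omit [FiniteDimensional K L] in
/-- If `σ` fixes the place `w`, then `‖(σ • x)_w‖ = ‖x_w‖`. -/
theorem InfiniteAdeleRing.norm_smul_apply_of_smul_place_eq (σ : L ≃ₐ[K] L) (x : InfiniteAdeleRing L)
    {w : InfinitePlace L} (h : σ • w = w) : ‖(σ • x) w‖ = ‖x w‖ := by
  have key : ∀ {v v' : InfinitePlace L}, v = v' → ‖(σ • x) v‖ = ‖(σ • x) v'‖ := by
    rintro v _ rfl; rfl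
  rw [← key h]
  exact InfiniteAdeleRing.norm_smul_apply_smul K σ x w

omit [FiniteDimensional K L] in
/-- The closed "polydisc" `{x : ∀ w, ‖x_w‖ ≤ 1} ⊆ L_∞` is compact (each `L_w` embeds isometrically in `ℂ`). -/
theorem InfiniteAdeleRing.isCompact_normLeOne : IsCompact {x : InfiniteAdeleRing L | ∀ w, ‖x w‖ ≤ 1} := by
  have hball : ∀ w : InfinitePlace L, IsCompact (Metric.closedBall (0 : w.Completion) 1) := fun w => by
    have h := (InfinitePlace.Completion.isometry_extensionEmbedding w).preimage_closedBall 0 1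
    rw [map_zero] at h
    rw [← h]
    exact (InfinitePlace.Completion.isometry_extensionEmbedding w).isClosedEmbedding.isCompact_preimage
      (isCompact_closedBall _ _)
  have hset : {x : InfiniteAdeleRing L | ∀ w, ‖x w‖ ≤ 1} =
      Set.univ.pi fun w : InfinitePlace L => Metric.closedBall (0 : w.Completion) 1 := by
    ext x
    refine ⟨fun h w _ => ?_, fun h w => ?_⟩
    · rw [Metric.mem_closedBall, dist_zero_right]; exact h w
    · have h' := h w (Set.mem_univ w); rwa [Metric.mem_closedBall, dist_zero_right] at h'
  rw [hset]
  exact isCompact_univ_pi hball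

end Continuity

section CMCompact

variable (L : Type) [Field L] [NumberField L] [IsCMField L]

/-- Complex conjugation of a CM field fixes every infinite place. -/
theorem complexConj_smul_infinitePlace (w : InfinitePlace L) : IsCMField.complexConj L • w = w := by
  ext x
  rw [InfinitePlace.smul_apply,
    show (IsCMField.complexConj L).symm x = IsCMField.complexConj L x from
      (AlgEquiv.symm_apply_eq _).mpr (IsCMField.complexConj_apply_apply L x).symm]
  exact IsCMField.infinitePlace_complexConj L w x

/-- On the archimedean torus of a CM field every local component has absolute value one:
`y ȳ = 1 ⇒ |y_w| = 1` at each (complex) place `w`. -/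
theorem norm_apply_eq_one_of_mem_unitaryLineArchTorus {y : (InfiniteAdeleRing L)ˣ}
    (hy : y ∈ unitaryLineArchTorus L) (w : InfinitePlace L) : ‖(y : InfiniteAdeleRing L) w‖ = 1 := by
  have hy' := (mem_relNormOneInfUnits_iff_mul_conj L y).mp hy
  have h1 : (y : InfiniteAdeleRing L) w * (IsCMField.complexConj L • (y : InfiniteAdeleRing L)) w = 1 :=
    congrArg (fun u : (InfiniteAdeleRing L)ˣ => (u : InfiniteAdeleRing L) w) hy'
  have h2 : ‖(IsCMField.complexConj L • (y : InfiniteAdeleRing L)) w‖ = ‖(y : InfiniteAdeleRing L) w‖ :=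
    InfiniteAdeleRing.norm_smul_apply_of_smul_place_eq (maximalRealSubfield L) L _ _
      (complexConj_smul_infinitePlace L w)
  have h3 : ‖(y : InfiniteAdeleRing L) w‖ * ‖(y : InfiniteAdeleRing L) w‖ = 1 := by
    nth_rw 2 [← h2]
    rw [← norm_mul, h1, norm_one]
  rcases mul_self_eq_one_iff.mp h3 with h | h
  · exact h
  · exact absurd h (by have := norm_nonneg ((y : InfiniteAdeleRing L) w); intro h'; linarith)

/-- **`U(W_j)(L₀ ⊗ ℝ)` is compact** for a hermitian line over a CM extension: the archimedean torus is a closed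
subgroup of `L_∞^×` contained in `{|y_w| = 1 ∀ w} = ∏_w U(1)`. -/
theorem isCompact_unitaryLineArchTorus : IsCompact (unitaryLineArchTorus L : Set (InfiniteAdeleRing L)ˣ) := by
  have hC := InfiniteAdeleRing.isCompact_normLeOne L
  have hemb := Units.isClosedEmbedding_embedProduct (α := InfiniteAdeleRing L)
  rw [hemb.isInducing.isCompact_iff]
  refine (hC.prod (hC.image MulOpposite.continuous_op)).of_isClosed_subset
    (hemb.isClosedMap _ (isClosed_relNormOneInfUnits (maximalRealSubfield L) L)) ?_
  rintro _ ⟨y, hy, rfl⟩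
  refine ⟨fun w => (norm_apply_eq_one_of_mem_unitaryLineArchTorus L hy w).le, ?_⟩
  exact ⟨((y⁻¹ : (InfiniteAdeleRing L)ˣ) : InfiniteAdeleRing L),
    fun w => (norm_apply_eq_one_of_mem_unitaryLineArchTorus L (inv_mem hy) w).le, rfl⟩

/-- `U(W_j)(L₀ ⊗ ℝ)` is a compact (abelian) topological group. -/
instance compactSpace_unitaryLineArchTorus : CompactSpace (unitaryLineArchTorus L) :=
  isCompact_iff_compactSpace.mp (isCompact_unitaryLineArchTorus L)

end CMCompact

end NumberField

end
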